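import Mathlib.MeasureTheory.Function.ConvergenceInDistribution
import Mathlib.MeasureTheory.Function.LpSeminorm.CompareExp
import Mathlib.Analysis.SpecialFunctions.Exp
import Mathlib.Analysis.SpecialFunctions.Pow.NNReal
import Mathlib.Topology.ContinuousMap.Compact
import Mathlib.Topology.UniformSpace.CompactConvergence
import HarnessLib

/-!
# Moments from sub-exponential tails, and tails of distributional limits

Topic `Literature/Probability/Process`; theorems only. Two generic steps of the passage to the
scaling limit in Kemppainen–Smirnov, *Random curves, scaling limits and Loewner evolutions*, Ann.
Probab. 45 (2017): Prop. 3.8 and Thm. 1.5 (v) bound the running maximum of the driving processes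
of the discrete curves UNIFORMLY over the family,
`P(sup_{0 ≤ s ≤ n} |W_s| > b) ≤ K exp(-c b/(4√n))` (eq. (19) of arXiv:1212.6215, proof of
Prop. 3.8), and the main theorem then asserts the moment bound for every subsequential LIMIT `P*`
("there exists `ε > 0` such that for any `t`, `E*[exp(ε |W_t|/√t)] < ∞`"). The two generic facts
used implicitly there are proved here:

* `measure_lt_comp_le_of_tendstoInDistribution` — **tails pass to distributional limits**: if
  `X_i → Z` in distribution (Mathlib `TendstoInDistribution`), `g` is a continuous real functional
  and eventually `P_i(g(X_i) > a) ≤ B`, then `P(g(Z) > a) ≤ B` (portmanteau theorem for the open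
  set `{g > a}`, Mathlib `ProbabilityMeasure.le_liminf_measure_open_of_tendsto`);
* `memLp_natCast_of_measure_lt_abs_le` — **sub-exponential tails give all moments**: if
  `μ(|f| > n) ≤ K e^{-c n}` for all integers `n ≥ n₀` (`c > 0`, `μ` finite), then `f ∈ L^k(μ)`
  for every `k : ℕ` (pointwise `|f|^k ≤ ∑ₙ (n+2)^k 1{|f| > n}` and
  `∑ₙ (n+2)^k e^{-cn} < ∞`);
* `exists_memLp_forall_abs_le_of_tendstoInDistribution` — the assembled form consumed by the
  FK-Ising identification step (clause "`∀ t, ∃ M ∈ L³(μ), 0 ≤ M, a.e. ∀ u ≤ t, |W_u| ≤ M`" of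
  `LatticeModels.exists_cylinderObservableIdentity_fkInterface`, there with `k = 3`): for
  continuous-path processes `V^i → W` in distribution in `C([0, ∞), ℝ)` whose running maxima
  `sup_{u ≤ t} |V^i_u|` have eventually-uniform sub-exponential tails, the running maximum
  `M = sup_{u ≤ t} |W_u|` of the limit is in every `L^k` and bounds `|W_u|`, `u ≤ t`, surely.

## References

* A. Kemppainen, S. Smirnov, Ann. Probab. 45 (2017) 698–779 (arXiv:1212.6215), Prop. 3.8 and
  its proof (eq. (19)), Thm. 1.5 (v).
* P. Billingsley, *Convergence of Probability Measures*, 2nd ed. (1999), Thm. 2.1 (portmanteau).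
-/

noncomputable section

open MeasureTheory Filter Topology Set
open scoped NNReal ENNReal

namespace Literature.Probability.Process

/-! ### Sub-exponential tails give all moments -/

/-- Pointwise layer-cake bound with integer levels: for `a ≥ 0` and `k ≥ 1`,
`a^k ≤ ∑ₙ (n+2)^k · 1{n < a}` (in `ℝ≥0∞`; one term of the sum already dominates: `n = ⌊a⌋`
if `a` is not an integer, `n = a - 1` if it is a positive integer). [folklore] -/
theorem ofReal_pow_le_tsum_indicator {a : ℝ} (ha : 0 ≤ a) {k : ℕ} (hk : 1 ≤ k) :
    ENNReal.ofReal a ^ k ≤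
      ∑' n : ℕ, ((n : ℝ≥0∞) + 2) ^ k * (if (n : ℝ) < a then 1 else 0) := by
  -- a term `n` with `n < a ≤ n + 2` dominates
  have key : ∀ n : ℕ, (n : ℝ) < a → a ≤ n + 2 →
      ENNReal.ofReal a ^ k ≤ ∑' n : ℕ, ((n : ℝ≥0∞) + 2) ^ k * (if (n : ℝ) < a then 1 else 0) := by
    intro n hn hle
    refine le_trans ?_ (ENNReal.le_tsum n)
    rw [if_pos hn, mul_one]
    have h1 : ENNReal.ofReal a ≤ (n : ℝ≥0∞) + 2 := by
      have : ((n : ℝ≥0∞) + 2) = ENNReal.ofReal ((n : ℝ) + 2) := by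
        rw [ENNReal.ofReal_add (by positivity) (by norm_num), ENNReal.ofReal_natCast,
          ENNReal.ofReal_ofNat]
      rw [this]
      exact ENNReal.ofReal_le_ofReal hle
    gcongr
  set N := ⌊a⌋₊ with hN
  by_cases hlt : (N : ℝ) < a
  · exact key N hlt (by linarith [Nat.lt_floor_add_one a])
  · have haN : a = N := le_antisymm (not_lt.1 hlt) (Nat.floor_le ha)
    rcases Nat.eq_zero_or_pos N with h0 | hpos
    · -- `a = 0`
      have ha0 : a = 0 := by rw [haN, h0, Nat.cast_zero]
      rw [ha0, ENNReal.ofReal_zero, zero_pow (by omega)]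
      exact zero_le
    · obtain ⟨M, hM⟩ := Nat.exists_eq_succ_of_ne_zero hpos.ne'
      refine key M ?_ ?_
      · rw [haN, hM]
        push_cast
        linarith
      · rw [haN, hM]
        push_cast
        linarith

/-- **Sub-exponential tails at integer levels give all moments.** Let `μ` be a finite measure,
`f` a.e.-strongly measurable and real-valued, `c > 0`, and suppose
`μ {n < |f|} ≤ K e^{-c n}` for all integers `n ≥ n₀`. Then `f ∈ L^k(μ)` for every `k : ℕ`.
(Used by Kemppainen–Smirnov 2017, Prop. 3.8 ⇒ Thm. 1.5 (v), with the tail `K e^{-c b/√t}` of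
the running maximum of the driving process.) [folklore] -/
theorem memLp_natCast_of_measure_lt_abs_le {α : Type*} {m : MeasurableSpace α} {μ : Measure α}
    [IsFiniteMeasure μ] {f : α → ℝ} (hf : AEStronglyMeasurable f μ) (k : ℕ) {K c : ℝ}
    (hc : 0 < c) (n₀ : ℕ)
    (htail : ∀ n : ℕ, n₀ ≤ n → μ {ω | (n : ℝ) < |f ω|} ≤ ENNReal.ofReal (K * Real.exp (-c * n))) :
    MemLp f k μ := by
  rcases Nat.eq_zero_or_pos k with rfl | hk
  · simpa using hf
  -- reduce to a strongly measurable representative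
  set g : α → ℝ := hf.mk f with hg
  have hfg : f =ᵐ[μ] g := hf.ae_eq_mk
  have hgm : Measurable g := hf.stronglyMeasurable_mk.measurable
  suffices hgoal : MemLp g k μ from hgoal.ae_eq hfg.symm
  have htail' : ∀ n : ℕ, n₀ ≤ n →
      μ {ω | (n : ℝ) < |g ω|} ≤ ENNReal.ofReal (K * Real.exp (-c * n)) := by
    intro n hn
    have hset : {ω | (n : ℝ) < |g ω|} =ᵐ[μ] {ω | (n : ℝ) < |f ω|} := by
      filter_upwards [hfg] with ω hω
      simp only [eq_iff_iff]
      show (n : ℝ) < |g ω| ↔ (n : ℝ) < |f ω|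
      rw [hω]
    rw [measure_congr hset]
    exact htail n hn
  -- a uniform tail constant valid for all `n`
  set K' : ℝ := max K 0 + μ.real univ * Real.exp (c * n₀) with hK'
  have hK'0 : 0 ≤ K' := by positivity
  have hbound : ∀ n : ℕ, μ {ω | (n : ℝ) < |g ω|} ≤ ENNReal.ofReal (K' * Real.exp (-c * n)) := by
    intro n
    by_cases hn : n₀ ≤ n
    · refine (htail' n hn).trans (ENNReal.ofReal_le_ofReal ?_)
      have : K ≤ K' := (le_max_left K 0).trans (le_add_of_nonneg_right (by positivity))
      exact mul_le_mul_of_nonneg_right this (Real.exp_nonneg _)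
    · have hle : (n : ℝ) ≤ n₀ := by exact_mod_cast (not_le.1 hn).le
      calc μ {ω | (n : ℝ) < |g ω|} ≤ μ univ := measure_mono (subset_univ _)
        _ = ENNReal.ofReal (μ.real univ) := (ofReal_measureReal (measure_ne_top μ _)).symm
        _ ≤ ENNReal.ofReal (K' * Real.exp (-c * n)) := by
          refine ENNReal.ofReal_le_ofReal ?_
          have h1 : μ.real univ ≤ μ.real univ * Real.exp (c * n₀) * Real.exp (-c * n) := by
            rw [mul_assoc, ← Real.exp_add]
            have : (1 : ℝ) ≤ Real.exp (c * n₀ + -c * n) := Real.one_le_exp (by nlinarith)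
            nlinarith [measureReal_nonneg (μ := μ) (s := univ)]
          have h2 : μ.real univ * Real.exp (c * n₀) ≤ K' := le_add_of_nonneg_left (le_max_right K 0)
          nlinarith [Real.exp_nonneg (-c * n), h2]
  -- the moment bound
  refine ⟨hgm.aestronglyMeasurable, ?_⟩
  rw [eLpNorm_lt_top_iff_lintegral_rpow_enorm_lt_top (by exact_mod_cast hk.ne')
    (ENNReal.natCast_ne_top k)]
  simp only [ENNReal.toReal_natCast, ENNReal.rpow_natCast]
  -- `∫ |g|^k ≤ ∑ₙ (n+2)^k μ{n < |g|} ≤ ∑ₙ (n+2)^k K' e^{-cn} < ∞`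
  have hpt : ∀ ω, ‖g ω‖ₑ ^ k ≤
      ∑' n : ℕ, ((n : ℝ≥0∞) + 2) ^ k * ({ω | (n : ℝ) < |g ω|}.indicator 1 ω) := by
    intro ω
    have h := ofReal_pow_le_tsum_indicator (abs_nonneg (g ω)) hk
    rw [← Real.enorm_eq_ofReal_abs] at h
    refine h.trans (le_of_eq (tsum_congr fun n ↦ ?_))
    simp only [indicator, mem_setOf_eq, Pi.one_apply]
  have hmeas : ∀ n : ℕ, MeasurableSet {ω | (n : ℝ) < |g ω|} := fun n ↦
    measurableSet_lt measurable_const (continuous_abs.measurable.comp hgm)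
  calc ∫⁻ ω, ‖g ω‖ₑ ^ k ∂μ
      ≤ ∫⁻ ω, ∑' n : ℕ, ((n : ℝ≥0∞) + 2) ^ k * ({ω | (n : ℝ) < |g ω|}.indicator 1 ω) ∂μ :=
        lintegral_mono hpt
    _ = ∑' n : ℕ, ((n : ℝ≥0∞) + 2) ^ k * μ {ω | (n : ℝ) < |g ω|} := by
        rw [lintegral_tsum fun n ↦ ?_]
        · refine tsum_congr fun n ↦ ?_
          rw [lintegral_const_mul _ (measurable_one.indicator (hmeas n)),
            lintegral_indicator_one (hmeas n)]
        · exact (measurable_const.mul (measurable_one.indicator (hmeas n))).aemeasurable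
    _ ≤ ∑' n : ℕ, ENNReal.ofReal (((n : ℝ) + 2) ^ k * (K' * Real.exp (-c * n))) := by
        refine ENNReal.tsum_le_tsum fun n ↦ ?_
        rw [ENNReal.ofReal_mul (by positivity), ENNReal.ofReal_pow (by positivity),
          ENNReal.ofReal_add (by positivity) (by norm_num), ENNReal.ofReal_natCast,
          ENNReal.ofReal_ofNat]
        exact mul_le_mul' le_rfl (hbound n)
    _ < ∞ := by
        rw [← ENNReal.ofReal_tsum_of_nonneg (fun n ↦ by positivity) ?_]
        · exact ENNReal.ofReal_lt_top
        -- summability: shift `n ↦ n + 2` of `n^k e^{-cn}`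
        have hs := (summable_nat_add_iff 2).2 (Real.summable_pow_mul_exp_neg_nat_mul k hc)
        have hs' : Summable fun n : ℕ ↦ K' * Real.exp (2 * c) * (((n + 2 : ℕ) : ℝ) ^ k *
            Real.exp (-c * ((n + 2 : ℕ) : ℝ))) := hs.mul_left _
        refine hs'.congr fun n ↦ ?_
        push_cast
        have : Real.exp (-c * ((n : ℝ) + 2)) = Real.exp (-c * n) * Real.exp (-(2 * c)) := by
          rw [← Real.exp_add]; ring_nf
        rw [this]
        have h2 : Real.exp (2 * c) * Real.exp (-(2 * c)) = 1 := by
          rw [← Real.exp_add, add_neg_cancel, Real.exp_zero]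
        calc K' * Real.exp (2 * c) * (((n : ℝ) + 2) ^ k * (Real.exp (-c * n) * Real.exp (-(2 * c))))
            = ((n : ℝ) + 2) ^ k * (K' * Real.exp (-c * n)) * (Real.exp (2 * c) * Real.exp (-(2 * c))) := by
              ring
          _ = ((n : ℝ) + 2) ^ k * (K' * Real.exp (-c * n)) := by rw [h2, mul_one]

/-! ### Tails pass to distributional limits -/

section Limit

variable {ι E Ω' : Type*} {Ω : ι → Type*} {mΩ : ∀ i, MeasurableSpace (Ω i)}
  {P : ∀ i, Measure (Ω i)} [∀ i, IsProbabilityMeasure (P i)] {mΩ' : MeasurableSpace Ω'}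
  {μ : Measure Ω'} [IsProbabilityMeasure μ] [TopologicalSpace E] {mE : MeasurableSpace E}
  [OpensMeasurableSpace E] {X : ∀ i, Ω i → E} {Z : Ω' → E} {l : Filter ι}

/-- **Tail bounds pass to distributional limits** (portmanteau for the open set `{g > a}`):
if `X_i → Z` in distribution along a nontrivial filter, `g : E → ℝ` is continuous and eventually
`P_i {a < g(X_i)} ≤ B`, then `μ {a < g(Z)} ≤ B`. (Billingsley 1999, Thm. 2.1 (iv).)
[folklore] -/
theorem measure_lt_comp_le_of_tendstoInDistribution [l.NeBot]
    (h : TendstoInDistribution X l Z P μ) {g : E → ℝ} (hg : Continuous g) (a : ℝ) {B : ℝ≥0∞}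
    (hB : ∀ᶠ i in l, P i {ω | a < g (X i ω)} ≤ B) : μ {ω | a < g (Z ω)} ≤ B := by
  -- push forward to `ℝ` (continuous mapping theorem) and apply the portmanteau theorem there
  have h' := h.continuous_comp hg
  have hUo : IsOpen (Ioi a) := isOpen_Ioi
  have hZ : μ {ω | a < g (Z ω)} = (μ.map (g ∘ Z)) (Ioi a) := by
    rw [Measure.map_apply_of_aemeasurable h'.aemeasurable_limit hUo.measurableSet]
    rfl
  have hX : ∀ i, P i {ω | a < g (X i ω)} = ((P i).map (g ∘ X i)) (Ioi a) := fun i ↦ by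
    rw [Measure.map_apply_of_aemeasurable (h'.forall_aemeasurable i) hUo.measurableSet]
    rfl
  have hport := ProbabilityMeasure.le_liminf_measure_open_of_tendsto h'.tendsto hUo
  rw [hZ]
  refine hport.trans (liminf_le_of_frequently_le' (Eventually.frequently ?_))
  filter_upwards [hB] with i hi
  simpa [hX i] using hi

end Limit

/-! ### The running maximum of a distributional limit of continuous processes -/

section RunningMax

variable {ι Ω' : Type*} {Ω : ι → Type*} {mΩ : ∀ i, MeasurableSpace (Ω i)}
  {P : ∀ i, Measure (Ω i)} [∀ i, IsProbabilityMeasure (P i)] {mΩ' : MeasurableSpace Ω'}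
  {μ : Measure Ω'} [IsProbabilityMeasure μ] {l : Filter ι}

/-- The running maximum `sup_{u ≤ t} |w u|` of a continuous path, realised as the sup norm of the
restriction of `w` to the compact interval `[0, t]`, is a continuous functional on
`C([0, ∞), ℝ)` (compact-open topology). [folklore] -/
theorem continuous_norm_restrict_Icc (t : ℝ≥0) :
    Continuous fun w : C(ℝ≥0, ℝ) ↦
      ‖(haveI := isCompact_iff_compactSpace.1 (isCompact_Icc (a := (0 : ℝ≥0)) (b := t));
        w.restrict (Icc (0 : ℝ≥0) t))‖ := by
  haveI := isCompact_iff_compactSpace.1 (isCompact_Icc (a := (0 : ℝ≥0)) (b := t))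
  exact continuous_norm.comp (ContinuousMap.continuous_restrict _)

/-- For `u ≤ t`, `|w u|` is at most the sup norm of `w` restricted to `[0, t]`. [folklore] -/
theorem abs_apply_le_norm_restrict_Icc {t : ℝ≥0} (w : C(ℝ≥0, ℝ)) {u : ℝ≥0} (hu : u ≤ t) :
    |w u| ≤ ‖(haveI := isCompact_iff_compactSpace.1 (isCompact_Icc (a := (0 : ℝ≥0)) (b := t));
        w.restrict (Icc (0 : ℝ≥0) t))‖ := by
  haveI := isCompact_iff_compactSpace.1 (isCompact_Icc (a := (0 : ℝ≥0)) (b := t))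
  have := (w.restrict (Icc (0 : ℝ≥0) t)).norm_coe_le_norm ⟨u, zero_le, hu⟩
  simpa using this

/-- The sup norm of `w` restricted to `[0, t]` exceeds `a ≥ 0` iff `|w u| > a` for some
`u ≤ t`. [folklore] -/
theorem lt_norm_restrict_Icc_iff {t : ℝ≥0} (w : C(ℝ≥0, ℝ)) {a : ℝ} (ha : 0 ≤ a) :
    a < ‖(haveI := isCompact_iff_compactSpace.1 (isCompact_Icc (a := (0 : ℝ≥0)) (b := t));
        w.restrict (Icc (0 : ℝ≥0) t))‖ ↔ ∃ u, u ≤ t ∧ a < |w u| := by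
  haveI := isCompact_iff_compactSpace.1 (isCompact_Icc (a := (0 : ℝ≥0)) (b := t))
  rw [← not_le, ContinuousMap.norm_le _ ha]
  push Not
  constructor
  · rintro ⟨⟨u, hu0, hut⟩, hu⟩
    exact ⟨u, hut, by simpa using hu⟩
  · rintro ⟨u, hut, hu⟩
    exact ⟨⟨u, zero_le, hut⟩, by simpa using hu⟩

/-- **The running maximum of a distributional limit is in every `L^k`, given uniform
sub-exponential tails.** Let `V^i` (on `(Ω i, P i)`) and `W` (on `(Ω', μ)`) be real processes
with continuous paths, `V^i → W` in distribution in `C([0, ∞), ℝ)` along a nontrivial filter,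
and suppose that for some `c > 0`, `K`, `n₀` and every integer `n ≥ n₀`, eventually in `i`,
`P_i(∃ u ≤ t, |V^i_u| > n) ≤ K e^{-c n}` (Kemppainen–Smirnov 2017, proof of Prop. 3.8, eq. (19):
`P(sup_{0≤s≤t} |W_s| > b) ≤ K exp(-c b/(4√t))`, uniformly over the family). Then there is
`M : Ω' → ℝ`, `M ≥ 0`, in `L^k(μ)` for the prescribed `k : ℕ`, with `|W_u ω| ≤ M ω` for ALL `ω`
and `u ≤ t` — namely the running maximum `M = sup_{u ≤ t} |W_u|`. With `k = 3` this is the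
moment clause of `LatticeModels.exists_cylinderObservableIdentity_fkInterface` for a limit driving
process. [folklore] -/
theorem exists_memLp_forall_abs_le_of_tendstoInDistribution
    [MeasurableSpace C(ℝ≥0, ℝ)] [OpensMeasurableSpace C(ℝ≥0, ℝ)] [l.NeBot]
    {W : ℝ≥0 → Ω' → ℝ} (hWc : ∀ ω, Continuous (W · ω))
    {V : ∀ i, ℝ≥0 → Ω i → ℝ} (hVc : ∀ i ω, Continuous (V i · ω))
    (hlaw : TendstoInDistribution (fun i ω ↦ (⟨fun u ↦ V i u ω, hVc i ω⟩ : C(ℝ≥0, ℝ))) l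
      (fun ω ↦ (⟨fun u ↦ W u ω, hWc ω⟩ : C(ℝ≥0, ℝ))) P μ)
    (t : ℝ≥0) (k : ℕ) {K c : ℝ} (hc : 0 < c) (n₀ : ℕ)
    (htail : ∀ n : ℕ, n₀ ≤ n →
      ∀ᶠ i in l, P i {ω | ∃ u, u ≤ t ∧ (n : ℝ) < |V i u ω|} ≤ ENNReal.ofReal (K * Real.exp (-c * n))) :
    ∃ M : Ω' → ℝ, MemLp M k μ ∧ (∀ ω, 0 ≤ M ω) ∧ ∀ ω u, u ≤ t → |W u ω| ≤ M ω := by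
  haveI := isCompact_iff_compactSpace.1 (isCompact_Icc (a := (0 : ℝ≥0)) (b := t))
  set g : C(ℝ≥0, ℝ) → ℝ := fun w ↦ ‖w.restrict (Icc (0 : ℝ≥0) t)‖ with hgdef
  have hg : Continuous g := continuous_norm_restrict_Icc t
  set pW : Ω' → C(ℝ≥0, ℝ) := fun ω ↦ ⟨fun u ↦ W u ω, hWc ω⟩ with hpW
  refine ⟨fun ω ↦ g (pW ω), ?_, fun ω ↦ norm_nonneg _, fun ω u hu ↦ ?_⟩
  · refine memLp_natCast_of_measure_lt_abs_le (K := K)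
      (hg.measurable.comp_aemeasurable hlaw.aemeasurable_limit).aestronglyMeasurable k hc n₀
      fun n hn ↦ ?_
    have hset : {ω | (n : ℝ) < |(g ∘ pW) ω|} = {ω | (n : ℝ) < g (pW ω)} := by
      ext ω
      simp only [mem_setOf_eq, Function.comp_apply, abs_of_nonneg (norm_nonneg _), hgdef]
    rw [hset]
    refine measure_lt_comp_le_of_tendstoInDistribution hlaw hg n ?_
    filter_upwards [htail n hn] with i hi
    refine le_trans (le_of_eq (congrArg _ ?_)) hi
    ext ω
    simp only [mem_setOf_eq]
    exact lt_norm_restrict_Icc_iff _ (Nat.cast_nonneg n)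
  · exact abs_apply_le_norm_restrict_Icc (pW ω) hu

end RunningMax

end Literature.Probability.Process
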